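import Summits.SmoothPoincare4.SmoothPoincare4.Theses.SchoenfliesSplit
import Literature.Topology.FourManifolds.CerfTheoremOne
import Literature.Topology.FourManifolds.ClosedBallProofs

/-!
# `SchsplitCerf` — two natural strengthenings are false (negative lemmas, crux stmt-SmoothPoincare4-8758)

* `not_forall_isDiffeotopicToId_sphere_three`: the orientation-naive reading of Cerf's Théorème 1
  ("every self-diffeomorphism of `S³` is diffeotopic to the identity") is FALSE — a hyperplane
  reflection reverses orientation (tree: `not_isDiffeotopicToId_sphereReflection`).  The crux itself
  survives because reflections extend linearly over `D⁴`; a proof by isotopy must split by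
  orientation class.
* `not_subsingleton_diffeomorph_sphere_four`, `not_forall_subsingleton_twistedSphere_diffeomorph`:
  the identification `T.carrier ≅ S⁴` asserted by the crux is never unique (identity vs. reflection),
  so "canonical diffeomorphism" strengthenings are false and gluing uniqueness is a genuine theorem.
cdisprove seat.
-/

noncomputable section

-- the prescribed namespace `Summit.<P>.<Sub>.…` duplicates `SmoothPoincare4` (P = Sub)
set_option linter.dupNamespace false

open scoped Manifold ContDiff Topology

namespace Summit.SmoothPoincare4.SmoothPoincare4.Theorems.SchsplitCerf.Negative

open Literature.Topology.FourManifolds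

/-- **Not every diffeomorphism of `S³` is diffeotopic to the identity** (a hyperplane reflection is
not). [cite: HirschDT1976, Ch. 8 §1, Exercise 7(a)] -/
theorem not_forall_isDiffeotopicToId_sphere_three :
    ¬ ∀ φ : (Metric.sphere (0 : EuclideanSpace ℝ (Fin 4)) 1) ≃ₘ⟮𝓡 3, 𝓡 3⟯
        (Metric.sphere (0 : EuclideanSpace ℝ (Fin 4)) 1), Diffeomorph.IsDiffeotopicToId φ := by
  intro h
  have v : Metric.sphere (0 : EuclideanSpace ℝ (Fin 4)) 1 := ⟨EuclideanSpace.single 0 1, by simp⟩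
  exact not_isDiffeotopicToId_sphereReflection (n := 3) (by norm_num) v (h _)

/-- **`Diff(S⁴)` is not a subsingleton**: the identity and a hyperplane reflection differ (the
reflection in `vᗮ` moves `v`). [folklore] -/
theorem not_subsingleton_diffeomorph_sphere_four :
    ¬ Subsingleton ((Metric.sphere (0 : EuclideanSpace ℝ (Fin 5)) 1) ≃ₘ⟮𝓡 4, 𝓡 4⟯
        (Metric.sphere (0 : EuclideanSpace ℝ (Fin 5)) 1)) := by
  intro h
  let v : Metric.sphere (0 : EuclideanSpace ℝ (Fin 5)) 1 := ⟨EuclideanSpace.single 0 1, by simp⟩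
  have hfix : sphereReflection v v = v := by
    rw [Subsingleton.elim (sphereReflection v)
      (Diffeomorph.refl (𝓡 4) (Metric.sphere (0 : EuclideanSpace ℝ (Fin 5)) 1) ∞)]
    rfl
  rw [sphereReflection_eq_self_iff, real_inner_self_eq_norm_sq, norm_eq_of_mem_sphere] at hfix
  norm_num at hfix

/-- **The identification asserted by the crux is never canonical**: the strengthening of
`SchsplitCerf` from `Nonempty (T.carrier ≃ₘ S⁴)` to `Subsingleton (T.carrier ≃ₘ S⁴)` fails already
for the untwisted sphere `TwistedSphere.sphere`. [folklore] -/
theorem not_forall_subsingleton_twistedSphere_diffeomorph :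
    ¬ ∀ (φ : (Metric.sphere (0 : EuclideanSpace ℝ (Fin 4)) 1) ≃ₘ⟮𝓡 3, 𝓡 3⟯
          (Metric.sphere (0 : EuclideanSpace ℝ (Fin 4)) 1)) (T : TwistedSphere 3 φ),
        Subsingleton (T.carrier ≃ₘ⟮𝓡 4, 𝓡 4⟯ (Metric.sphere (0 : EuclideanSpace ℝ (Fin 5)) 1)) :=
  fun h => not_subsingleton_diffeomorph_sphere_four
    (h _ (TwistedSphere.sphere isDouble_sphere_holds))

end Summit.SmoothPoincare4.SmoothPoincare4.Theorems.SchsplitCerf.Negative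

end
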